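import Summits.CriticalPhenomena.PercolationContinuityZ3.Theorems.PercNearOneGluingNoHeavyLowerTailSahiCombTriWCylinder
import Summits.CriticalPhenomena.PercolationContinuityZ3.Theorems.PercNearOneGluingNoHeavyLowerTailSahiCombTriWFibreFour

/-!
# `TriWIneq` for every cylinder (one or two extra coordinates) over every up-set of `2^4`

Support file of the one-cut programme (crux `NoHeavyLowerTail`, stmt-CriticalPhenomena-4575; TRI lane of cell `prim-masterthm`; seat prim-lf-1 gen 40).
The cylinder lemma of `…SahiCombTriWCylinder` (`sandwichCert_optCyl`) applied to P5 gen 24's computational certificates for the `168` up-sets of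
`Finset (Fin 4)` (`…SahiCombTriWFibreFour`, `sandwichCert_fin_four`): for every up-set `P ⊆ Finset (Fin 4)` the cylinders
`optCyl P ⊆ Finset (Option (Fin 4))` (dimension 5) and `optCyl (optCyl P) ⊆ Finset (Option (Option (Fin 4)))` (dimension 6) satisfy
`0 ≤ triW _ F G` for EVERY index cube and all monotone families of up-sets.  New cases (not saturated, not relatively saturated, not
threshold): the cylinders over the `K₂₂` orbit `(x₀ ∨ x₁)(x₂ ∨ x₃)` and over the two other non-saturated `|Z| = 2` orbits of `2^4`.
HONEST LABEL: corollary of the cylinder lemma (std axioms in this file) and of the computational certificate table of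
`…SahiCombTriWFibreFourCert` (`native_decide`, audit lane, imported); `TriWIneq` itself stays OPEN. [this work]
-/

namespace Summit.CriticalPhenomena.PercolationContinuityZ3.Theorems

namespace FiveUpSet

open Finset

variable {β : Type} [DecidableEq β] [Fintype β]

/-- **Dimension 5 cylinders over `2^4`**: for every up-set `P ⊆ Finset (Fin 4)`, `0 ≤ triW (optCyl P) F G` for every index cube and all monotone
families `F, G` of up-sets of `Finset (Option (Fin 4))`. [this work] -/
theorem triW_nonneg_optCyl_fin_four (P : Finset (Finset (Fin 4))) (hP : IsUpperSet (P : Set (Finset (Fin 4))))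
    (F G : Finset β → Finset (Finset (Option (Fin 4))))
    (hF : ∀ x, IsUpperSet (F x : Set (Finset (Option (Fin 4))))) (hG : ∀ x, IsUpperSet (G x : Set (Finset (Option (Fin 4)))))
    (hFm : Monotone F) (hGm : Monotone G) :
    0 ≤ triW (optCyl P) F G :=
  triW_nonneg_optCyl_of_sandwichCert (row_of_mem P P P hP hP hP).1 (fun _ => monoLit_litF _) (fun _ => monoLit_litF _)
    (sandwichCert_fin_four P hP) F G hF hG hFm hGm

/-- **Dimension 6 cylinders over `2^4`** (two dummy coordinates): `0 ≤ triW (optCyl (optCyl P)) F G`. [this work] -/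
theorem triW_nonneg_optCyl_optCyl_fin_four (P : Finset (Finset (Fin 4))) (hP : IsUpperSet (P : Set (Finset (Fin 4))))
    (F G : Finset β → Finset (Finset (Option (Option (Fin 4)))))
    (hF : ∀ x, IsUpperSet (F x : Set (Finset (Option (Option (Fin 4))))))
    (hG : ∀ x, IsUpperSet (G x : Set (Finset (Option (Option (Fin 4))))))
    (hFm : Monotone F) (hGm : Monotone G) :
    0 ≤ triW (optCyl (optCyl P)) F G :=
  triW_nonneg_optCyl_of_sandwichCert (row_of_mem P P P hP hP hP).1
    (monoLit_cylLits fun _ => monoLit_litF _) (monoLit_cylLits fun _ => monoLit_litF _)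
    (sandwichCert_optCyl (fun _ => monoLit_litF _) (fun _ => monoLit_litF _) (sandwichCert_fin_four P hP)) F G hF hG hFm hGm

end FiveUpSet

end Summit.CriticalPhenomena.PercolationContinuityZ3.Theorems
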